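import Summits.BirchSwinnertonDyer.BirchSwinnertonDyer.Theorems.SchneiderFreeAdditiveX3UpperCoSocketConjFrame
import Summits.BirchSwinnertonDyer.BirchSwinnertonDyer.Theorems.SchneiderFreeAdditiveX3UpperCoSocketOfKYBranch
import Summits.BirchSwinnertonDyer.BirchSwinnertonDyer.Theorems.SchneiderFreeAdditiveX3BranchFlatRigidity
import Summits.BirchSwinnertonDyer.BirchSwinnertonDyer.Theorems.SchneiderFreeAdditiveX3BranchFrameMatchOfMultiplier
import Summits.BirchSwinnertonDyer.BirchSwinnertonDyer.Theorems.SchneiderFreeAdditiveX3PresentationLZZTwistValue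
import Summits.BirchSwinnertonDyer.BirchSwinnertonDyer.Theorems.SchneiderFreeAdditiveX3EndStateControlDischarged
import Literature.NumberTheory.EllipticCurves.CastellaHsieh2018.BranchBDPLFunctionExistenceSigned
import HarnessLib

/-!
# Route `SchneiderFreeAdditiveX3Upper` (K1 wing), crux r3 `GordTwoBranchCoIMCField` (stmt-BirchSwinnertonDyer-20365) ON THE LZZ/♭
# ROAD: the field-local (G-ord, `e = 2`) CO-socket BY NAME from PUBLISHED facts + ONE Keller–Yin claim — no value node, no sliver

Cell `bsd-schneider-ideate`, seat `bsd-schneider-door-c5` (prover, generation 20; assembly layer).  PARTITION: board row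
B6 ∩ X3 ∩ sst-twist, `r = 1`, (G-ord, `e = 2`) half, of `Rank1Residual.partition` — UPPER half of BSD_p; types-the-object-of
nothing new; closes none of B6's cells (BSD NOT advanced).  bears_on: K1-wing (route-BirchSwinnertonDyer-SchneiderFreeAdditiveX3Upper
item 20365 r3) ← K1-door seat (items 18971/18972).

THE ROAD (mirror of `…GordTwoBranchIMCOfLZZMatch`, UPWARD).  The wing crux is field-local with `d_K ≠ −3` and Keller–Yin's
lattice normalisation of `W` ITSELF among its binders, so NO sliver and NO isogeny descent are needed.  Per datum over such a
`K`, frame `(κ, γ, 𝔭)`, at the conjugate degree-one prime `𝔮 = 𝔭̄` with `ι′` inducing it: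
1. Castella–Hsieh SIGNED existence (`castellaHsieh2018_exists_isBranchBDPLFunction_signed`, PUBLISHED, p637933): a `χ_ε`-branch
   frame `L` of the good member `Dt′.f` at `(ι′, 𝔮)` with `e = ±1`;
2. Keller–Yin Thm. 3.5.1 (iii) in branch currency (`thm351_charIdeal_eq_branch_OPEN`, PREPRINT — the ONLY preprint input; NO
   `μ`-clause, NO clauses (i)/(ii)) at `(v, v̄) = (𝔮, 𝔭)` for `W` itself: `L = p^c·L₀`, `Ch_Λ(X_ac^∅(W_K) at 𝔭)·R₀⟦T⟧ = (L₀)`,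
   so `(L) ⊆ Ch·R₀⟦T⟧`;
3. BRANCH-vs-FLAT RIGIDITY (`LZZMatch.span_le_span_map_of_isBranchBDPLFunction_of_isBDPLFunctionInt`, p637681, co-integral case
   `ι′⁻¹(±1)·(±1) = 1`): for EVERY ♭-frame `Q` of `Dt.f` at `(ι′, 𝔮)`: `(Q) ⊆ (L)`; hence `(Q) ⊆ Ch·𝓞_{ℂ_p}⟦T⟧` = H3♭ᵒᵖᶜ;
4. the ♭-CO-socket (Hsieh Thm. A frame, LZZ value with unit cofactor, Kolyvagin; CTL₀ from the CLOSED control corner).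
So:
* §1 `Upper.additiveIMCUpperBDPOnTreeLeAt_of_kolyvagin_of_hsieh_of_lzz_of_intCoDivConj` — p634827's co-socket read PER DATUM;
* §2 `span_le_xac_charIdeal_map_of_KY_branch_of_castellaHsieh_signed` — steps 1–3 for the presented curve;
* §3 `additiveIMCUpperBDPInputManinAtField_of_hsieh_of_lzz_of_KY_branch_of_castellaHsieh_signed` (the crux's body at a field
  with `d_K ≠ −3`) and **`gordTwoBranchCoIMCField_of_hsieh_of_lzz_of_KY_branch_of_castellaHsieh_signed : … → GordTwoBranchCoIMCField`**
  — the wing crux r3 BY NAME ⇐ Kolyvagin ∧ modularity ∧ Hsieh 2014 Thm A ∧ Liu–Zhang–Zhang 2018 ∧ Castella–Hsieh signed existence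
  (all PUBLISHED) ∧ `thm351_charIdeal_eq_branch_OPEN` (ONE PREPRINT claim).  Versus the wing's record
  (`additiveIMCUpperBDPInputManinAt_of_facts_of_KY_branch_of_CHValueUnit`): the untyped value node `KYReadCHValueUnit`, the
  sliver `KYReadSliverUpper`, Cai–Shu–Tian and the CM-rationality input are GONE;
* §4 the wing LEAF `Upper.AdditiveX3RankOneUpper ⇐ PrintedFacts ∧ PotMultBranchCoIMC (r4) ∧ TwistUnitX3OffSliver (r2) ∧ Hsieh ∧
  LZZ ∧ KY (iii-branch) ∧ CH-signed` (`additiveX3RankOneUpper_of_printedFacts_of_coIMCs_of_twistUnit`, p631992).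

HONEST FRAMING: THEOREMS ONLY; pure composition of tree theorems; CONDITIONAL on the displayed hypotheses (Keller–Yin is an
unrefereed PREPRINT; wing cruxes r2/r4 stay as hypotheses); nothing is closed by me; BSD is proved for no curve; «closes rung: none».
References: [KellerYin2024b] arXiv:2410.23241 Thm. 3.5.1, Rem. 3.5.2 (preprint); [CastellaHsieh2018] §3.3, Def. 3.7, Prop. 3.8;
[Hsieh2014] Thm. A; [LiuZhangZhang2018] Thm 1.5.1/1.5.3; [JetchevSkinnerWan2017] §7.4.1; [Castella2018] Thm. 3.1; [Washington1997] §5.1.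
-/

set_option autoImplicit false
-- `Summit.<P>.<Sub>` repeats `BirchSwinnertonDyer` by the tree's layout convention (D-0017)
set_option linter.dupNamespace false

noncomputable section

open scoped Classical NumberField

open Field NumberField IsDedekindDomain WeierstrassCurve PowerSeries
  Literature.NumberTheory.EllipticCurves Literature.NumberTheory.EllipticCurves.GreenbergSelmer
  Literature.NumberTheory.GaloisRepresentations Literature.NumberTheory.GaloisCohomology
  Literature.NumberTheory.EllipticCurves.ModularForms Literature.NumberTheory.EllipticCurves.Rank1Residual
  Literature.NumberTheory.EllipticCurves.KellerYin2024
  Summit.BirchSwinnertonDyer.Rank1Residual Summit.BirchSwinnertonDyer.Rank1Residual.X11b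
  Summit.BirchSwinnertonDyer.Rank1Residual.X11b.AcSelmer Summit.BirchSwinnertonDyer.Rank1Residual.X11b.Halves
  Summit.BirchSwinnertonDyer.Rank1Residual.X11b.CongruenceLimit
  Summit.BirchSwinnertonDyer.BirchSwinnertonDyer.Theorems.SchneiderFree
  Summit.BirchSwinnertonDyer.BirchSwinnertonDyer.Theorems.SchneiderFree.Upper
  Summit.BirchSwinnertonDyer.BirchSwinnertonDyer.Theses.SchneiderFreeAdditiveX3
  Summit.BirchSwinnertonDyer.BirchSwinnertonDyer.Theorems.SchneiderFreeAdditiveX3.LZZMatch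

open Summit.BirchSwinnertonDyer.BirchSwinnertonDyer.Theses.SchneiderFreeAdditiveX3Upper

namespace Summit.BirchSwinnertonDyer.BirchSwinnertonDyer.Theorems.SchneiderFreeAdditiveX3.ControlDischarged

/-! ### §1 The ♭-CO-socket at the conjugate prime, ONE datum -/

/-- **The UPPER socket at ONE Heegner datum from Kolyvagin, Hsieh (any level), LZZ (additive) and the ♭-CO-divisibility AT THE
CONJUGATE PRIME at that datum** — p634827's `additiveIMCUpperBDPInputManinAt_of_kolyvagin_of_hsieh_of_lzz_of_intCoDivConj` read per
datum (proof verbatim): CTL₀ gives `n` with `Ch_Λ(X_ac^∅ at 𝔭) = (f)`, `ord_p f(0) = n`; Hsieh gives a ♭-frame `Q` of `Dt.f` at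
`(ι′, 𝔮)`; LZZ pins `Q(0) = u·(log_𝔮 P / c)²`, `‖u‖ = 1`; rank one gives `(log_𝔮 P)² = (log_𝔭 P)²`; the displayed co-divisibility
puts `Q` in `(f)·𝓞_{ℂ_p}⟦T⟧`; norms give `n + 2·v_p(c) ≤ 2·ord_p log_𝔭 P`.  CONDITIONAL on `hKo`, `hA`, `hL`, `hCoDiv`; nothing
asserted about any curve. [cite: JetchevSkinnerWan2017, §7.4.1 (arXiv:1512.06894 p. 30)] [cite: Hsieh2014, Thm. A p. 712 (Doc. Math. 19)]
[cite: LiuZhangZhang2018, Thm 1.5.1 and Thm 1.5.3 (Duke Math. J. 167 pp. 748–749)] [cite: SilvermanAEC2009, VIII.6.7 and IV.6.4] -/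
theorem additiveIMCUpperBDPOnTreeLeAt_of_kolyvagin_of_hsieh_of_lzz_of_intCoDivConj
    (hKo : ∀ (N : ℕ) [NeZero N] (W : WeierstrassCurve ℚ) (K : Type) [Field K] [NumberField K],
      Literature.NumberTheory.EllipticCurves.kolyvagin N W K)
    (hA : Hsieh2014.thmA_exists_isHsiehLFunction_unrPeriod_anyLevel)
    (hL : LiuZhangZhang2018.thm151_thm153_modularCurve_heegnerVector_additive)
    {W : WeierstrassCurve ℚ} [W.IsElliptic] [W.IsGloballyMinimal] {p : ℕ} [Fact p.Prime]
    (hp2 : p ≠ 2) (hX : ClassX3 W p) (hS : Additive.SubSemistableTwist W p)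
    {N : ℕ} [NeZero N] {K : Type} [Field K] [NumberField K]
    (Dt : ModularParametrizationData W N) (H : HeegnerDatum N (NumberField.discr K)) (ι : K →+* ℂ)
    (P : (W.baseChange K).toAffine.Point)
    (hr' : W.analyticRank = 1) (hloc : Additive.N10.Locus W p) (hN : W.conductorNorm ℤ = N) (hK : IsImaginaryQuadratic K)
    (hodd : Odd (NumberField.discr K)) (hunit : ¬ p ∣ Units.torsionOrder K) (hHe : SatisfiesHeegnerHypothesis N K)
    (hL1 : (W.quadraticTwist (NumberField.discr K : ℚ)).entireLFunction 1 ≠ 0)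
    (hP : WeierstrassCurve.Affine.Point.map ι.toRatAlgHom P = heegnerPointComplex Dt H) (hnt : ¬ IsOfFinAddOrder P)
    (κ : ZpExtension K p) (hκ : κ.IsAnticyclotomic) (γ : Field.absoluteGaloisGroup K) [Fact (κ.IsTopGenerator γ)]
    (𝔭 : HeightOneSpectrum (𝓞 K)) (h𝔭 : ((p : ℕ) : 𝓞 K) ∈ 𝔭.asIdeal)
    (he : 𝔭.asIdeal.ramificationIdx (𝓞 ℚ) = 1) (hf : 𝔭.asIdeal.inertiaDeg (𝓞 ℚ) = 1)
    (hCoDiv : ∀ (𝔮 : HeightOneSpectrum (𝓞 K)), ((p : ℕ) : 𝓞 K) ∈ 𝔮.asIdeal → 𝔭 ≠ 𝔮 →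
      𝔮.asIdeal.ramificationIdx (𝓞 ℚ) = 1 → 𝔮.asIdeal.inertiaDeg (𝓞 ℚ) = 1 →
      ∀ (ι' : PadicAlgCl p ≃+* ℂ), BranchInducesPrime p ι' 𝔮 →
        ∀ (ΩK : ℂ) (Ωp : ℂ_[p]) (Q : PowerSeries (PadicComplexInt p)), ΩK ≠ 0 → Ωp ≠ 0 →
          R1.IsBDPLFunctionInt p ι' 𝔮 κ γ Dt.f ΩK Ωp Q →
            Ideal.span {Q} ≤ (XAc.charIdeal (W.baseChange K) p κ 𝔭 ∅ γ).map (PowerSeries.map (R1.toCpInt p))) :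
    AdditiveIMCUpperBDPOnTreeLeAt p κ 𝔭 γ (embAt K p 𝔭 h𝔭 he hf) (padicValNat p Dt.c.natAbs) P := by
  have hp : p.Prime := Fact.out
  have hγ : κ.IsTopGenerator γ := Fact.out
  -- CTL₀: the characteristic ideal is principal with `ord_p f(0) = n`
  obtain ⟨n, hn⟩ := exists_hasCharValuationAt_of_pt_of_kolyvagin pt_selmer_forall hKo W p hr' hp2 hX hS N K Dt H ι P
    hr' hloc hN hK hodd hunit hHe hL1 hP hnt κ hκ γ 𝔭 h𝔭 he hf
  -- `p² ∣ N`
  have haddv : Addv W p := hloc.2.1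
  have hp2N : p ^ 2 ∣ N := by
    by_contra h
    rw [← hN] at h
    rcases hasGoodReductionAtPrime_or_hasMultiplicativeReductionAtPrime_of_not_sq_dvd_conductorNorm (V := W) h
      with hg | hm
    · exact haddv.1 hg
    · exact haddv.2 hm
  have hpN : p ∣ N := dvd_trans (dvd_pow_self p two_ne_zero) hp2N
  have hsplit : ((Ideal.span {(p : ℤ)}).primesOver (𝓞 K)).ncard = 2 := hHe p hp hpN
  -- the conjugate degree-one prime `𝔮 = 𝔭̄`, an embedding datum inducing it, Hsieh's frame there
  obtain ⟨𝔮, h𝔮, hne, he', hf'⟩ := exists_conjugate_degreeOne hK.1 h𝔭 he hf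
  obtain ⟨ι₀⟩ := PadicAlgCl.nonempty_ringEquiv_complex p
  obtain ⟨ι', -, hι'⟩ := exists_datum_forall_mem_iff p ι₀ hK h𝔮
  obtain ⟨lam, rlam, hlu, hinfl, hAQ, hunrl, havl, hfacl⟩ := lambdaSupplyAt hp2 ι' K κ hK hκ
  subst hN
  -- rank one over `K` (Kolyvagin), for the `𝔭 ↔ 𝔭̄` symmetry of `log_ω P`
  have hrk : (W.baseChange K).mordellWeilRank = 1 := (hKo _ W K hK hHe ⟨Dt, H, ι, hP⟩ hnt).1
  obtain ⟨A, ΩK₀, C, Ωp, Q₀, hA0, hΩK₀, hC, hQ₀⟩ :=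
    hA ι' K 𝔮 κ γ Dt.f lam rlam hp2 Dt.isNewformOf.1 hK hsplit h𝔮 hι' hHe hlu hinfl hAQ hunrl havl hfacl hκ hγ
  obtain ⟨ΩK, c, hΩK, -, hQ⟩ :=
    exists_isBDPLFunctionInt_of_isHsiehLFunction ι' 𝔮 κ γ Dt.f hpN hA0 hΩK₀ hC ((Ωp : unrIntegers p) : ℂ_[p]) hQ₀
  have hΩp : ((Ωp : unrIntegers p) : ℂ_[p]) ≠ 0 := fun h0 ↦ by
    have h1 := norm_coe_units_unrIntegers p Ωp
    rw [h0, norm_zero] at h1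
    exact zero_ne_one h1
  set Q : PowerSeries (PadicComplexInt p) := PowerSeries.C c * Q₀ with hQdef
  -- the value of the frame at `𝟙` (LZZ at `𝔭̄`, `‖u‖ = 1`), its logarithm moved to `𝔭`
  obtain ⟨u, hu, hval'⟩ :=
    UniversalToricDescentWaldspurgerFlat.intSeries_value_of_frame_tors hL W K 𝔮 κ γ Dt H ι P Dt.f Dt.isNewformOf
      hp2 rfl hp2N hK hunit h𝔮 he' hf' hHe hκ hP hnt ι' hι' hΩK hΩp hQ
  set x : ℚ_[p] := logOmega W p (embAt K p 𝔭 h𝔭 he hf) P / (Dt.c : ℚ_[p]) with hx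
  have hval : IntSeries.HasValueAt Q 0 (u * (algebraMap ℚ_[p] ℂ_[p] x) ^ 2) := by
    have hsq := sq_logOmega_embAt_eq_of_rank_one W p hK.1 hrk h𝔭 he hf h𝔮 he' hf' P
    have hx2 : (logOmega W p (embAt K p 𝔮 h𝔮 he' hf') P / (Dt.c : ℚ_[p])) ^ 2 = x ^ 2 := by
      rw [hx, div_pow, div_pow, hsq]
    rw [← map_pow, ← hx2, map_pow]
    exact hval'
  -- the ♭-co-divisibility at this frame
  have hcodiv := hCoDiv 𝔮 h𝔮 hne he' hf' ι' hι' ΩK _ Q hΩK hΩp hQ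
  -- the upper norm half over `𝓞_{ℂ_p}⟦T⟧` (verbatim p634827)
  obtain ⟨htors, f, hfI, hf0, hfn⟩ := hn
  have hmem : Q ∈ Ideal.span {PowerSeries.map (R1.toCpInt p) f} := by
    have h3 := hcodiv
    rw [hfI, map_span_singleton_powerSeries] at h3
    exact (Ideal.span_singleton_le_iff_mem _).mp h3
  have hQ0 : u * (algebraMap ℚ_[p] ℂ_[p] x) ^ 2 = ((constantCoeff Q : PadicComplexInt p) : ℂ_[p]) :=
    R1.intSeries_eq_constantCoeff_of_hasValueAt_zero p hval
  obtain ⟨G, hG⟩ := Ideal.mem_span_singleton'.mp hmem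
  have hfac : ((constantCoeff Q : PadicComplexInt p) : ℂ_[p]) =
      ((constantCoeff G : PadicComplexInt p) : ℂ_[p]) * algebraMap ℚ_[p] ℂ_[p] ((constantCoeff f : ℤ_[p]) : ℚ_[p]) := by
    rw [← R1.coe_toCpInt, ← constantCoeff_map_apply (R1.toCpInt p) f, ← hG, map_mul, MulMemClass.coe_mul]
  have hp1 : (1 : ℝ) < p := by exact_mod_cast hp.one_lt
  have hnormf : ‖x‖ ^ 2 ≤ ‖((constantCoeff f : ℤ_[p]) : ℚ_[p])‖ := by
    calc ‖x‖ ^ 2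
        = ‖u‖ * ‖algebraMap ℚ_[p] ℂ_[p] x‖ ^ 2 := by rw [hu, one_mul, norm_algebraMap']
      _ = ‖((constantCoeff Q : PadicComplexInt p) : ℂ_[p])‖ := by rw [← hQ0, norm_mul, norm_pow]
      _ = ‖((constantCoeff G : PadicComplexInt p) : ℂ_[p])‖ *
            ‖algebraMap ℚ_[p] ℂ_[p] ((constantCoeff f : ℤ_[p]) : ℚ_[p])‖ := by rw [hfac, norm_mul]
      _ ≤ 1 * ‖algebraMap ℚ_[p] ℂ_[p] ((constantCoeff f : ℤ_[p]) : ℚ_[p])‖ :=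
          mul_le_mul_of_nonneg_right (R1.norm_coe_padicComplexInt_le_one p _) (norm_nonneg _)
      _ = ‖((constantCoeff f : ℤ_[p]) : ℚ_[p])‖ := by rw [one_mul, norm_algebraMap']
  -- `x ≠ 0`
  have hlog : logOmega W p (embAt K p 𝔭 h𝔭 he hf) P ≠ 0 := R1.logOmega_ne_zero W p _ hnt
  have hc0 : Dt.c ≠ 0 := Dt.maninConstant_ne_zero_holds
  have hc0' : (Dt.c : ℚ_[p]) ≠ 0 := by exact_mod_cast hc0
  have hx0 : x ≠ 0 := div_ne_zero hlog hc0'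
  -- norms to valuations: `ord_p f(0) = n ≤ 2·ord_p x`
  rw [← PadicInt.norm_def, PadicInt.norm_eq_zpow_neg_valuation hf0, Padic.norm_eq_zpow_neg_valuation hx0] at hnormf
  have hlhs : ((p : ℝ) ^ (-x.valuation)) ^ 2 = (p : ℝ) ^ (-(2 * x.valuation)) := by
    rw [← zpow_natCast ((p : ℝ) ^ (-x.valuation)) 2, ← zpow_mul]
    congr 1
    push_cast
    ring
  rw [hlhs, zpow_le_zpow_iff_right₀ hp1] at hnormf
  have hle : ((constantCoeff f).valuation : ℤ) ≤ 2 * x.valuation := by omega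
  rw [hx, div_eq_mul_inv, Padic.valuation_mul hlog (inv_ne_zero hc0'), Padic.valuation_inv,
    Padic.valuation_intCast, valuation_logOmega hlog, hfn] at hle
  refine ⟨n, ⟨htors, f, hfI, hf0, hfn⟩, ?_⟩
  simp only [padicValInt] at hle
  linarith

/-! ### §2 Steps 1–3 for the presented curve: H3♭ᵒᵖᶜ at EVERY ♭-frame from Keller–Yin (iii-branch) + Castella–Hsieh (signed) -/

/-- **H3♭ᵒᵖᶜ at a ♭-frame of the conjugate prime ⇐ Keller–Yin Thm. 3.5.1 (iii-branch, PREPRINT) ∧ Castella–Hsieh signed existence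
(PUBLISHED) ∧ branch-vs-flat rigidity.**  For the presented curve `W = C₂ • ((D • W′) ⊗ χ_{p*})` carrying Keller–Yin's per-curve
hypotheses ITSELF (`hN`, `hcase`, `hred`, `hlat`, `htf`), at a socket datum with `d_K` odd `≠ −3`, the socket's degree-one `𝔭`,
a second degree-one `𝔭′ ≠ 𝔭` above `p` and an `ι′` inducing it: for EVERY ♭-frame `Q` of `Dt.f` at `(ι′, 𝔭′)` with non-zero
periods, `(Q) ⊆ Ch_Λ(X_ac^∅(W_K) at 𝔭)·𝓞_{ℂ_p}⟦T⟧`.  Proof: signed branch frame `L` at `𝔭′`; Keller–Yin gives `L = p^c L₀`,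
`Ch·R₀⟦T⟧ = (L₀)`; rigidity (co-integral constant `ι′⁻¹(±1)`) gives `(Q) ⊆ (L) ⊆ (L₀)`.  NO `μ`-clause, NO clauses (i)/(ii).
CONDITIONAL on the named facts; nothing asserted about BSD.
[cite: KellerYin2024b, Thm. 3.5.1 and Rem. 3.5.2 (arXiv:2410.23241 p. 20) (preprint; hypotheses)]
[cite: CastellaHsieh2018, §3.3, Def. 3.7 and Prop. 3.8 (the signed branch frame)] [cite: Washington1997, §5.1 and §7.1] -/
theorem span_le_xac_charIdeal_map_of_KY_branch_of_castellaHsieh_signed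
    (hCHσ : castellaHsieh2018_exists_isBranchBDPLFunction_signed) (hKYb : thm351_charIdeal_eq_branch_OPEN)
    (hmodN : exists_isNewformOf)
    -- the prime, the good partner `W′`, the presentation of the door's curve
    {p : ℕ} [hp : Fact p.Prime] (hp2 : p ≠ 2) (W' : WeierstrassCurve ℚ) [W'.IsElliptic]
    (hgood : W'.HasGoodReductionAtPrime p) (D C₂ : VariableChange ℚ)
    [(C₂ • (D • W').quadraticTwist ((-1 : ℚ) ^ (p / 2) * p)).IsElliptic]
    [(C₂ • (D • W').quadraticTwist ((-1 : ℚ) ^ (p / 2) * p)).IsGloballyMinimal] {N : ℕ} [NeZero N]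
    (Dt : ModularParametrizationData (C₂ • (D • W').quadraticTwist ((-1 : ℚ) ^ (p / 2) * p)) N)
    {N' : ℕ} [NeZero N'] (Dt' : ModularParametrizationData W' N') (hpN' : ¬ p ∣ N')
    -- the socket's field, tower, primes, embedding datum; Heegner for `N` and for the partner's level
    {K : Type} [Field K] [NumberField K] [IsGalois ℚ K] (hK : IsImaginaryQuadratic K)
    (hHe : SatisfiesHeegnerHypothesis N K) (hHe' : SatisfiesHeegnerHypothesis N' K)
    (hodd : Odd (NumberField.discr K)) (hdK : NumberField.discr K ≠ -3)
    {κ : ZpExtension K p} (hκ : κ.IsAnticyclotomic) (γ : absoluteGaloisGroup K) [hγ : Fact (κ.IsTopGenerator γ)]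
    {𝔭 : HeightOneSpectrum (𝓞 K)} (h𝔭 : ((p : ℕ) : 𝓞 K) ∈ 𝔭.asIdeal)
    (he : 𝔭.asIdeal.ramificationIdx (𝓞 ℚ) = 1) (hf : 𝔭.asIdeal.inertiaDeg (𝓞 ℚ) = 1)
    {𝔭' : HeightOneSpectrum (𝓞 K)} (h𝔭' : ((p : ℕ) : 𝓞 K) ∈ 𝔭'.asIdeal) (hne : 𝔭 ≠ 𝔭')
    {ι' : PadicAlgCl p ≃+* ℂ} (hι' : BranchInducesPrime p ι' 𝔭')
    -- Keller–Yin's per-curve hypotheses for the presented curve ITSELF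
    (hN : (C₂ • (D • W').quadraticTwist ((-1 : ℚ) ^ (p / 2) * p)).conductorNorm ℤ = N)
    (hcase : (C₂ • (D • W').quadraticTwist ((-1 : ℚ) ^ (p / 2) * p)).HasGoodOrdinaryReductionOverQuadraticAt p)
    (hred : Red (C₂ • (D • W').quadraticTwist ((-1 : ℚ) ^ (p / 2) * p)) p)
    (hlat : ∃ Φ : AddSubgroup (geomTorsion (C₂ • (D • W').quadraticTwist ((-1 : ℚ) ^ (p / 2) * p)) (p : ℤ)),
      IsRationalLine (C₂ • (D • W').quadraticTwist ((-1 : ℚ) ^ (p / 2) * p)) p Φ ∧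
        ¬ LineDecompositionTrivialAt (C₂ • (D • W').quadraticTwist ((-1 : ℚ) ^ (p / 2) * p)) p Φ)
    (htf : ∀ Q : ((C₂ • (D • W').quadraticTwist ((-1 : ℚ) ^ (p / 2) * p)).baseChange K).toAffine.Point,
      p • Q = 0 → Q = 0)
    -- the ♭-frame at the conjugate prime
    {ΩK' : ℂ} {Ωp' : ℂ_[p]} {Q : PowerSeries (PadicComplexInt p)} (hΩK' : ΩK' ≠ 0) (hΩp' : Ωp' ≠ 0)
    (hQ : R1.IsBDPLFunctionInt p ι' 𝔭' κ γ Dt.f ΩK' Ωp' Q) :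
    Ideal.span {Q} ≤ (XAc.charIdeal ((C₂ • (D • W').quadraticTwist ((-1 : ℚ) ^ (p / 2) * p)).baseChange K) p κ 𝔭 ∅ γ).map
        (PowerSeries.map (R1.toCpInt p)) := by
  have hsplit : ((Ideal.span {(p : ℤ)}).primesOver (𝓞 K)).ncard = 2 :=
    ncard_primesOver_eq_two_of_degreeOne hK.1 h𝔭 he hf
  have hcond : ∀ 𝔮 : HeightOneSpectrum (𝓞 K), ((p : ℕ) : 𝓞 K) ∈ 𝔮.asIdeal →
      (KellerYin2024.genusHeckeCharacter K p).HasConductorExponentAt 𝔮 1 := fun 𝔮 h𝔮 ↦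
    KellerYin2024.genusHeckeCharacter_hasConductorExponentAt_one_of_split K p hp2 hK hsplit h𝔮
  -- step 1: the SIGNED branch frame of `(Dt′.f, χ_ε)` at `𝔭′`
  obtain ⟨e, ΩK, Ωp, L, hesign, hΩK, hL⟩ := hCHσ ι' W' K 𝔭' κ γ Dt'.isNewformOf (KellerYin2024.genusHeckeCharacter K p) hp2
    hpN' hK hodd hdK hsplit h𝔭' hι' hHe' hκ hγ.out (KellerYin2024.genusHeckeCharacter_sq K p)
    (fun w hw ↦ KellerYin2024.genusHeckeCharacter_isUnramifiedAt K p hw) hcond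
  have he0 : e ≠ 0 := by rcases hesign with rfl | rfl <;> norm_num
  have hΩp : ((Ωp : unrIntegers p) : ℂ_[p]) ≠ 0 := by
    rw [Ne, ZeroMemClass.coe_eq_zero]
    exact Ωp.ne_zero
  -- step 2: Keller–Yin (iii-branch) at `(v, v̄) = (𝔭′, 𝔭)` for the presented curve itself: `L = p^c·L₀`, `Ch·R₀⟦T⟧ = (L₀)`
  have hS : PotOrdSetting ι' (C₂ • (D • W').quadraticTwist ((-1 : ℚ) ^ (p / 2) * p)) K 𝔭' 𝔭 κ N :=
    potOrdSetting_of_socketData hp2 ι' _ K 𝔭 𝔭' κ N hN hcase hred hlat htf hK hHe hodd hdK hκ h𝔭 he hf hne hι'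
  have htw : ∃ S : Finset ℕ, ∀ ℓ : ℕ, ℓ.Prime → ℓ ∉ S →
      cuspCoeff Dt.f ℓ = ((legendreSym p ℓ : ℤ) : ℂ) * cuspCoeff Dt'.f ℓ :=
    exists_cofinite_cuspCoeff_eq_legendreSym_mul hp2 W' D C₂ Dt Dt'
  obtain ⟨c, L₀, hLL₀, -, heq⟩ := hKYb ι' _ K 𝔭' 𝔭 κ γ Dt.isNewformOf hS Dt'.isNewformOf.1 hpN' htw e ΩK
    ((Ωp : unrIntegers p) : ℂ_[p]) L he0 hΩK hΩp hL (toUnr p) (coe_toUnr p)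
  have h1 : (XAc.charIdeal ((C₂ • (D • W').quadraticTwist ((-1 : ℚ) ^ (p / 2) * p)).baseChange K) p κ 𝔭 ∅ γ).map
      (PowerSeries.map (toUnr p)) = Ideal.span {L₀} := by
    rw [xac_charIdeal_eq_literature, heq]
  have h2 := map_toCpInt_eq_span_of_map_toUnr_eq_span h1
  have h3 : Ideal.span {PowerSeries.map (R1.unrToCpInt p) L} ≤ Ideal.span {PowerSeries.map (R1.unrToCpInt p) L₀} := by
    rw [Ideal.span_singleton_le_iff_mem, hLL₀, map_mul]
    exact Ideal.mul_mem_left _ _ (Ideal.mem_span_singleton_self _)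
  -- step 3: rigidity — `(Q) ⊆ (L)` since the constant `ι′⁻¹(±1)` is co-integral
  have hKp : Algebra.IsUnramifiedIn (𝓞 K) (Ideal.span {(p : ℤ)}) := isUnramifiedIn_of_splitsTwo hK hsplit
  obtain ⟨c', -, hc'⟩ := exists_coe_eq_symm_of_sign (p := p) (ι := ι') hesign
  have h4 : Ideal.span {Q} ≤ Ideal.span {PowerSeries.map (R1.unrToCpInt p) L} :=
    span_le_span_map_of_isBranchBDPLFunction_of_isBDPLFunctionInt hp2 hK hKp Dt.f Dt'.f
      (fun _ hℓ hℓp ↦ cuspCoeff_eq_legendreSym_mul_of_presentation hp2 W' D C₂ Dt.isNewformOf Dt'.isNewformOf hℓ hℓp)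
      (cuspCoeff_prime_eq_zero_of_presentation hp2 W' hgood D C₂ Dt)
      (prime_dvd_level_of_presentation hmodN hp2 W' hgood D C₂ Dt)
      (fun _ hℓ hℓp ↦ dvd_level_iff_dvd_level_partner_of_presentation hmodN hp2 W' hgood D C₂ Dt Dt' hℓ hℓp)
      hκ hγ.out hΩK hΩK' hΩp hΩp' hL hQ hc'
  exact h4.trans (h3.trans h2.ge)

/-! ### §3 The wing crux r3 `GordTwoBranchCoIMCField` BY NAME from published facts + ONE Keller–Yin claim -/

/-- **The field-local (G-ord, `e = 2`) co-socket at a field with `d_K ≠ −3` for a curve with Keller–Yin's lattice normalisation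
⇐ Kolyvagin ∧ modularity ∧ Hsieh 2014 Thm A ∧ Liu–Zhang–Zhang 2018 ∧ Castella–Hsieh signed existence (PUBLISHED) ∧
`thm351_charIdeal_eq_branch_OPEN` (ONE PREPRINT claim)** — the body of the wing crux.  Per datum: present the curve through its
good-ordinary partner; Case (I) from `SubGordTwo`, `Red` from the rational line; §1 fed with §2 at every ♭-frame of the
conjugate prime.  NO value node, NO sliver, NO Cai–Shu–Tian.  CONDITIONAL; nothing asserted about BSD.
[cite: KellerYin2024b, Thm. 3.5.1 and Rem. 3.5.2 (arXiv:2410.23241 p. 20) (preprint; hypotheses)]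
[cite: CastellaHsieh2018, §3.3, Def. 3.7 and Prop. 3.8] [cite: Hsieh2014, Thm. A p. 712 (Doc. Math. 19)]
[cite: LiuZhangZhang2018, Thm 1.5.1 and Thm 1.5.3 (Duke Math. J. 167 pp. 748–749)] [cite: AtkinLehner1970, Thm. 4] -/
theorem additiveIMCUpperBDPInputManinAtField_of_hsieh_of_lzz_of_KY_branch_of_castellaHsieh_signed
    (hKo : ∀ (N : ℕ) [NeZero N] (W : WeierstrassCurve ℚ) (K : Type) [Field K] [NumberField K],
      Literature.NumberTheory.EllipticCurves.kolyvagin N W K)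
    (hPar : nonempty_modularParametrizationData)
    (hA : Hsieh2014.thmA_exists_isHsiehLFunction_unrPeriod_anyLevel)
    (hL : LiuZhangZhang2018.thm151_thm153_modularCurve_heegnerVector_additive)
    (hKYb : thm351_charIdeal_eq_branch_OPEN) (hCHσ : castellaHsieh2018_exists_isBranchBDPLFunction_signed)
    {W : WeierstrassCurve ℚ} [W.IsElliptic] [W.IsGloballyMinimal] {p : ℕ} [Fact p.Prime]
    (hp2 : p ≠ 2) (hX : ClassX3 W p) (hSG : Additive.SubGordTwo W p)
    (hlat : ∃ Φ : AddSubgroup (geomTorsion W (p : ℤ)), IsRationalLine W p Φ ∧ ¬ LineDecompositionTrivialAt W p Φ)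
    (K : Type) [Field K] [NumberField K] (hdK : NumberField.discr K ≠ -3) :
    AdditiveIMCUpperBDPInputManinAtField W p K := by
  have hp : p.Prime := Fact.out
  -- Case (I) and reducibility for the curve itself (KY's per-curve hypotheses; `hlat` is given)
  have hcase : W.HasGoodOrdinaryReductionOverQuadraticAt p :=
    hasGoodOrdinaryReductionOverQuadraticAt_of_subGordTwo hp2 W hX hSG
  obtain ⟨Φ₀, hΦ₀, -⟩ := id hlat
  have hred : Red W p := red_of_isRationalLine hΦ₀
  -- present the door's curve through its good-ordinary partner
  obtain ⟨W', hE', hmin', C₂, hW, hord, hΔ⟩ :=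
    exists_goodOrd_partner_presentation_of_subGordTwo_odd hp2 W hX hSG
  subst hW
  haveI : NeZero (W'.conductorNorm ℤ) := ⟨(WeierstrassCurve.conductorNorm_pos_holds W').ne'⟩
  intro N _ Dt H ι P hr' hloc hN hK hodd hunit hHe hL1 hP hnt htf κ hκ γ _ 𝔭 h𝔭 he hf
  refine additiveIMCUpperBDPOnTreeLeAt_of_kolyvagin_of_hsieh_of_lzz_of_intCoDivConj hKo hA hL hp2 hX (Or.inr hSG) Dt H ι P
    hr' hloc hN hK hodd hunit hHe hL1 hP hnt κ hκ γ 𝔭 h𝔭 he hf ?_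
  intro 𝔮 h𝔮 hne he' hf' ι' hι' ΩK Ωp Q hΩK hΩp hQ
  -- a parametrisation datum of the partner; `K/ℚ` is Galois
  obtain ⟨Dt'⟩ := hPar W'
  haveI : IsGalois ℚ K := Literature.FieldTheory.Galois.isGalois_of_finrank_eq_two hK.1
  -- the partner's level is prime to `p` and inherits the Heegner hypothesis (`N_{W′} ∣ N`)
  have hpN' : ¬ p ∣ W'.conductorNorm ℤ := not_dvd_conductorNorm_of_hasGoodReductionAtPrime W' hord.1
  have hmodN : exists_isNewformOf := exists_isNewformOf_of_nonempty_modularParametrizationData hPar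
  have hHe' : SatisfiesHeegnerHypothesis (W'.conductorNorm ℤ) K :=
    SatisfiesHeegnerHypothesis.of_dvd (conductorNorm_partner_dvd_level hmodN hp2 W' hord.1 _ C₂ Dt) hHe
  exact span_le_xac_charIdeal_map_of_KY_branch_of_castellaHsieh_signed hCHσ hKYb hmodN hp2 W' hord.1 _ C₂ Dt Dt' hpN' hK hHe
    hHe' hodd hdK hκ γ h𝔭 he hf h𝔮 hne hι' hN hcase hred hlat htf hΩK hΩp hQ

/-- **Wing crux r3 `GordTwoBranchCoIMCField` (item 20365) BY NAME ⇐ Kolyvagin ∧ modularity ∧ Hsieh 2014 Thm. A ∧ Liu–Zhang–Zhang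
2018 ∧ Castella–Hsieh signed existence (all PUBLISHED) ∧ Keller–Yin Thm. 3.5.1 (iii) in branch currency (ONE PREPRINT claim).**
No value node, no sliver (the crux is field-local with `d_K ≠ −3`), no Cai–Shu–Tian, no CM-rationality input, no Poitou–Tate binder
(CTL₀ from the CLOSED control corner).  CONDITIONAL on the displayed hypotheses; the crux stays OPEN (preprint); BSD NOT advanced.
[cite: KellerYin2024b, Thm. 3.5.1, Rem. 3.5.2 and Assumption 2.0.3 (arXiv:2410.23241 pp. 8, 20) (preprint; hypotheses)]
[cite: CastellaHsieh2018, §3.3, Def. 3.7 and Prop. 3.8] [cite: Hsieh2014, Thm. A p. 712 (Doc. Math. 19)]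
[cite: LiuZhangZhang2018, Thm 1.5.1 and Thm 1.5.3 (Duke Math. J. 167 pp. 748–749)] -/
theorem gordTwoBranchCoIMCField_of_hsieh_of_lzz_of_KY_branch_of_castellaHsieh_signed
    (hKo : ∀ (N : ℕ) [NeZero N] (W : WeierstrassCurve ℚ) (K : Type) [Field K] [NumberField K],
      Literature.NumberTheory.EllipticCurves.kolyvagin N W K)
    (hPar : nonempty_modularParametrizationData)
    (hA : Hsieh2014.thmA_exists_isHsiehLFunction_unrPeriod_anyLevel)
    (hL : LiuZhangZhang2018.thm151_thm153_modularCurve_heegnerVector_additive)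
    (hKYb : thm351_charIdeal_eq_branch_OPEN) (hCHσ : castellaHsieh2018_exists_isBranchBDPLFunction_signed) :
    GordTwoBranchCoIMCField := by
  intro W _ _ p _ hp2 hX hSG hlat K _ _ _ hdK
  exact additiveIMCUpperBDPInputManinAtField_of_hsieh_of_lzz_of_KY_branch_of_castellaHsieh_signed hKo hPar hA hL hKYb hCHσ hp2
    hX hSG hlat K hdK

/-! ### §4 The wing LEAF from `PrintedFacts`, the wing's cruxes r2/r4 and the LZZ/♭-road inputs of r3 -/

/-- **The wing's rung leaf `SchneiderFree.Upper.AdditiveX3RankOneUpper` ⇐ `PrintedFacts` ∧ `PotMultBranchCoIMC` (wing r4) ∧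
`TwistUnitX3OffSliver` (wing r2) ∧ Hsieh 2014 Thm A ∧ Liu–Zhang–Zhang 2018 ∧ Keller–Yin (iii-branch, PREPRINT) ∧ Castella–Hsieh
signed existence** (`additiveX3RankOneUpper_of_printedFacts_of_coIMCs_of_twistUnit`, p631992, with `hCoG` supplied by §3).
CONDITIONAL (wing r2/r4 have no printed input; Keller–Yin is a preprint); closes no item by name; BSD is NOT advanced.
[cite: KellerYin2024b, Thm. 3.5.1 (arXiv:2410.23241 p. 20) (preprint; hypotheses)] [cite: CastellaHsieh2018, §3.3, Def. 3.7 and Prop. 3.8]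
[cite: Hsieh2014, Thm. A p. 712 (Doc. Math. 19)] [cite: LiuZhangZhang2018, Thm 1.5.1 and Thm 1.5.3 (Duke Math. J. 167 pp. 748–749)] -/
theorem additiveX3RankOneUpper_of_printedFacts_of_potMultCo_of_twistUnit_of_hsieh_of_lzz_of_KY_branch_of_castellaHsieh_signed
    (hF : Summit.BirchSwinnertonDyer.BirchSwinnertonDyer.Theses.SchneiderFreeAdditiveX3.PrintedFacts)
    (hCoM : PotMultBranchCoIMC) (hTU : TwistUnitX3OffSliver)
    (hA : Hsieh2014.thmA_exists_isHsiehLFunction_unrPeriod_anyLevel)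
    (hL : LiuZhangZhang2018.thm151_thm153_modularCurve_heegnerVector_additive)
    (hKYb : thm351_charIdeal_eq_branch_OPEN) (hCHσ : castellaHsieh2018_exists_isBranchBDPLFunction_signed) :
    Upper.AdditiveX3RankOneUpper := by
  obtain ⟨-, hKo, -, -, hPar, -⟩ := id hF
  exact additiveX3RankOneUpper_of_printedFacts_of_coIMCs_of_twistUnit hF
    (gordTwoBranchCoIMCField_of_hsieh_of_lzz_of_KY_branch_of_castellaHsieh_signed hKo hPar hA hL hKYb hCHσ) hCoM hTU

end Summit.BirchSwinnertonDyer.BirchSwinnertonDyer.Theorems.SchneiderFreeAdditiveX3.ControlDischarged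

end
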